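import Literature.Analysis.FluidPDE.PressureReconstruction
import Literature.Analysis.FluidPDE.WeakSolutionLift
import Literature.Analysis.FunctionSpaces.TorusSpaceTime
import Literature.Analysis.FunctionSpaces.TorusCalculusProofs
import Literature.Analysis.FunctionSpaces.FlatTorusProofs
import Literature.Analysis.FunctionSpaces.SmoothParametricSetIntegral
import HarnessLib

/-!
# Reconstruction of the pressure on the flat torus

Analysis/FluidPDE support file (serves the discharge of the Buckmaster–Vicol vanishing-viscosity
fact `Literature.Barriers.AnomalousDissipation.BuckmasterVicol2019_mollifiedEulerStart`: the
mollification of a weak Euler solution satisfies the Euler–Reynolds system *with a pressure*,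
Buckmaster–Vicol 2019, §2.5: "Since `u` is a solution of the Euler equations, there exists a
mean-free `p_n` such that `∂ₜ v_n + div (v_n ⊗ v_n) + ∇p_n - λ_n^{-2} Δ v_n = div R̊_n`").
It is the torus twin of `PressureReconstruction` (whole space): a jointly smooth time-dependent
field `G` on `S × T^d`, `S` open, whose slices are `L²`-orthogonal to all smooth divergence-free
fields of the torus, is a gradient, `G(t) = ∇q(t)`, for a jointly smooth `q` whose slices have
zero mean (`Torus.exists_smooth_pressure_of_forall_integral_inner_eq_zero`).

## The argument (Galdi, *Navier–Stokes*, Lemma III.1.1; Temam, *Navier–Stokes Equations*,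
Ch. I Prop. 1.1 and Rem. 1.6 (periodic case))

* *To the covering space.* The lift `g = G ∘ proj : ℝ^d → ℝ^d` is orthogonal to every compactly
  supported smooth divergence-free test field `φ` of `ℝ^d`, because
  `∫_{ℝ^d} ⟪g, φ⟫ = ∫_{T^d} ⟪G, periodize φ⟫` (unfolding, `Torus.integral_eq_integral_perSum_repr`)
  and the periodisation of `φ` is smooth and divergence free on `T^d`
  (`Torus.forall_integral_inner_lift_eq_zero`).
* *Whole-space de Rham and Poincaré* (`PressureReconstruction`): `Dg` is symmetric and the
  segment potential `Q(y) = ∫₀¹ ⟪g(σy), y⟫ dσ` has `∇Q = g`.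
* *Periods.* `Q(y + eⱼ) - Q(y)` has zero derivative (`g` is periodic), hence is a constant `cⱼ`;
  then `θ = Q - ∑ⱼ cⱼ yⱼ` is `ℤ^d`-periodic with `∇θ = g - c`, it descends to a smooth `Θ` on the
  torus with `∇Θ = G - c`, and testing against the constant (divergence-free) field `c` gives
  `0 = ∫ ⟪G, c⟫ = ∫ ⟪∇Θ, c⟫ + |c|² = |c|²` (integration by parts on the torus), so `c = 0`:
  `Q` itself is periodic (`Torus.isLatticePeriodic_segmentPotential_lift`).
* *Descent, time dependence, zero mean.* `q₁(t) = Q(t) ∘ repr` is jointly smooth on `S × T^d`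
  (its lift is the jointly smooth whole-space potential, `IsSmoothSpaceTimeOn.segmentIntegral`)
  with `∇q₁(t) = G(t)`; subtracting the mean `m(t) = ∫ q₁(t)`, which is smooth in `t`
  (differentiation under the integral over the unit cube,
  `Literature.Analysis.FunctionSpaces.contDiff_parametric_setIntegral`), gives the mean-free
  pressure.

## Mathlib / tree search

Mathlib (this pin) has Poincaré's lemma for `1`-forms on convex sets
(`Convex.exists_forall_hasFDerivAt_of_fderiv_symmetric`) and nothing on the torus or on
divergence-free orthogonality (searched `deRham`, `Helmholtz`, `solenoidal`: none relevant). The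
tree has the whole-space reconstruction (`PressureReconstruction`), periodisation
(`TorusPeriodization`, `WeakSolutionLift`) and integration by parts on the torus
(`TorusCalculusProofs`). **Nearest tree object:** `TorusLerayHelmholtzSpaceTime` discharges the
full space–time Helmholtz–Weyl decomposition `G = w + ∇φ` (`Torus.smooth_leray_helmholtz_holds`)
for fields jointly smooth on *all* of `ℝ × T^d`, by parametric Fourier synthesis; the present
file treats only the gradient case but **locally in time** (`G` smooth on `S × T^d` for an open
`S`, orthogonality assumed only on `S`), which is the form delivered by testing a weak Euler
solution against mollified fields, and by an elementary real-variable route (covering space,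
segment potential, periods) that does not pass through Fourier series. No named facts are
introduced here.

## References

* G. P. Galdi, *An Introduction to the Mathematical Theory of the Navier–Stokes Equations*,
  2nd ed. (2011), Lemma III.1.1.
* R. Temam, *Navier–Stokes Equations*, 3rd ed. (1984), Ch. I, Prop. 1.1, Rem. 1.6.
* T. Buckmaster, V. Vicol, Ann. of Math. 189 (2019), §2.5.
-/

noncomputable section

open MeasureTheory TopologicalSpace Set Function Filter Metric
open Literature.Analysis.FunctionSpaces
open _root_.Topology
open scoped ContDiff RealInnerProductSpace

namespace Literature.Analysis.FluidPDE

variable {d : Type*} [Fintype d] [DecidableEq d]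

/-! ### From the torus to the covering space -/

section Lift

/-- Constant vector fields on the torus are divergence free (private copy of
`Torus.isDivFree_const_field` of `NSUniqueness2DTruncatedBalance`, not imported here). [folklore] -/
private theorem Torus.isDivFree_const (c : EuclideanSpace ℝ d) :
    Torus.IsDivFree (fun _ : UnitAddTorus d => c) := by
  intro x
  simp [Torus.divergence, Torus.partialDeriv, Torus.lineDeriv]

/-- **The periodisation of a compactly supported smooth divergence-free field of `ℝ^d` is a
smooth divergence-free field of `T^d`**: `div (periodize φ)(x) = tr ∑ₖ Dφ(y + k) =
∑ₖ div φ (y + k) = 0` (`y = repr x`; Grafakos 2014, §3.1.1 for the smoothness). [folklore] -/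
theorem Torus.isDivFree_periodize {φ : EuclideanSpace ℝ d → EuclideanSpace ℝ d}
    (hφ : IsTestFunctionOn (⊤ : Opens (EuclideanSpace ℝ d)) φ) (hdiv : VectorCalculus.IsDivFree φ) :
    Torus.IsDivFree (Torus.periodize φ) := by
  obtain ⟨R, hR⟩ := hφ.hasCompactSupport.isCompact.isBounded.subset_closedBall 0
  obtain ⟨n, hn⟩ := exists_nat_ge (R + Fintype.card d)
  intro x
  have h1 : ContDiff ℝ 1 φ := hφ.contDiff.of_le (by exact_mod_cast le_top)
  have hper : Torus.IsContDiff 1 (Torus.periodize φ) := Torus.isContDiff_periodize h1 hR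
  rw [Torus.divergence_eq_trace_fderiv hper, Torus.fderiv_periodize' h1 hR,
    Torus.perSum_eq_sum_of_mem_unitCube ((support_fderiv_subset ℝ).trans hR)
      (Torus.repr_mem_unitCube x) hn,
    ContinuousLinearMap.toLinearMap_sum, map_sum]
  exact Finset.sum_eq_zero fun k _ => hdiv _

/-- **Unfolding a pairing.** For a continuous field `G` on `T^d` and a compactly supported smooth
`φ` on `ℝ^d`, `∫_{ℝ^d} ⟪G ∘ proj, φ⟫ = ∫_{T^d} ⟪G, periodize φ⟫` (Stein–Weiss, Ch. VII §2,
Thm. 2.4: unfolding of integrals over a fundamental domain). [folklore] -/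
theorem Torus.integral_inner_lift_eq_integral_inner_periodize
    {G : UnitAddTorus d → EuclideanSpace ℝ d} (hG : Continuous G)
    {φ : EuclideanSpace ℝ d → EuclideanSpace ℝ d}
    (hφ : IsTestFunctionOn (⊤ : Opens (EuclideanSpace ℝ d)) φ) :
    ∫ y, ⟪Torus.lift G y, φ y⟫ = ∫ x, ⟪G x, Torus.periodize φ x⟫ := by
  obtain ⟨R, hR⟩ := hφ.hasCompactSupport.isCompact.isBounded.subset_closedBall 0
  have hsupp : support φ ⊆ closedBall 0 R := (subset_tsupport φ).trans hR
  have hsupp' : support (fun y => ⟪Torus.lift G y, φ y⟫) ⊆ closedBall 0 R :=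
    fun y hy => hsupp fun h0 => hy (by simp [h0])
  have hint : Integrable (fun y => ⟪Torus.lift G y, φ y⟫) volume := by
    have hc : Continuous fun y => ⟪Torus.lift G y, φ y⟫ :=
      (hG.comp Torus.continuous_proj).inner hφ.contDiff.continuous
    exact hc.integrable_of_hasCompactSupport (hφ.hasCompactSupport.mono' fun y hy =>
      subset_tsupport φ fun h0 => hy (by simp [h0]))
  rw [Torus.integral_eq_integral_perSum_repr hint hsupp']
  refine integral_congr_ae (Eventually.of_forall fun x => ?_)
  show Torus.perSum (fun y => ⟪Torus.lift G y, φ y⟫) (Torus.repr x) = ⟪G x, Torus.periodize φ x⟫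
  rw [Torus.perSum_inner_lift hsupp G (Torus.repr x), Torus.lift_repr, Torus.periodize_apply]

/-- **From torus orthogonality to whole-space orthogonality.** If a continuous field `G` on `T^d`
is `L²`-orthogonal to every smooth divergence-free field of the torus, then its lift `G ∘ proj`
is orthogonal to every compactly supported smooth divergence-free field of `ℝ^d` (unfold the
pairing and periodise the test field). [folklore] -/
theorem Torus.forall_integral_inner_lift_eq_zero {G : UnitAddTorus d → EuclideanSpace ℝ d}
    (hG : Continuous G)
    (horth : ∀ w : UnitAddTorus d → EuclideanSpace ℝ d, Torus.IsSmooth w → Torus.IsDivFree w →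
      ∫ x, ⟪G x, w x⟫ = 0)
    (φ : EuclideanSpace ℝ d → EuclideanSpace ℝ d)
    (hφ : IsTestFunctionOn (⊤ : Opens (EuclideanSpace ℝ d)) φ) (hdiv : VectorCalculus.IsDivFree φ) :
    ∫ y, ⟪Torus.lift G y, φ y⟫ = 0 := by
  classical
  obtain ⟨R, hR⟩ := hφ.hasCompactSupport.isCompact.isBounded.subset_closedBall 0
  rw [Torus.integral_inner_lift_eq_integral_inner_periodize hG hφ]
  exact horth _ (Torus.isSmooth_periodize hφ.contDiff hR) (Torus.isDivFree_periodize hφ hdiv)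

end Lift

/-! ### The segment potential of the lift and its periods -/

section Potential

/-- The **segment potential** of a field `g` on `ℝ^d`: `Q(y) = ∫₀¹ ⟪g(σ y), y⟫ dσ`
(Poincaré's lemma; `hasGradientAt_segmentIntegral`). [folklore] -/
def segmentPotential (g : EuclideanSpace ℝ d → EuclideanSpace ℝ d) (y : EuclideanSpace ℝ d) : ℝ :=
  ∫ σ in (0 : ℝ)..1, ⟪g (σ • y), y⟫

omit [DecidableEq d] in
/-- Unfolding `segmentPotential`. [folklore] -/
theorem segmentPotential_apply (g : EuclideanSpace ℝ d → EuclideanSpace ℝ d)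
    (y : EuclideanSpace ℝ d) : segmentPotential g y = ∫ σ in (0 : ℝ)..1, ⟪g (σ • y), y⟫ := rfl

omit [DecidableEq d] in
/-- The segment potential of a smooth field is smooth (a parametric integral of the smooth
integrand `(σ, y) ↦ ⟪g(σ y), y⟫`, `Literature.Analysis.FunctionSpaces.contDiff_parametric_intervalIntegral`).
[folklore] -/
theorem contDiff_segmentPotential {g : EuclideanSpace ℝ d → EuclideanSpace ℝ d}
    (hg : ContDiff ℝ ∞ g) : ContDiff ℝ ∞ (segmentPotential g) := by
  have hH : ContDiff ℝ ∞ fun q : ℝ × EuclideanSpace ℝ d => ⟪g (q.1 • q.2), q.2⟫ :=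
    (hg.comp (contDiff_fst.smul contDiff_snd)).inner ℝ contDiff_snd
  exact FunctionSpaces.contDiff_parametric_intervalIntegral hH 0 1

variable {G : UnitAddTorus d → EuclideanSpace ℝ d}

/-- For a smooth field `G` on the torus orthogonal to smooth divergence-free fields, the segment
potential `Q` of the lift `g = G ∘ proj` has `∇Q = g` (whole-space de Rham + Poincaré,
`PressureReconstruction`). [folklore] -/
theorem Torus.hasGradientAt_segmentPotential_lift (hG : Torus.IsSmooth G)
    (horth : ∀ w : UnitAddTorus d → EuclideanSpace ℝ d, Torus.IsSmooth w → Torus.IsDivFree w →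
      ∫ x, ⟪G x, w x⟫ = 0) (y : EuclideanSpace ℝ d) :
    HasGradientAt (segmentPotential (Torus.lift G)) (Torus.lift G y) y :=
  hasGradientAt_segmentIntegral hG (inner_fderiv_comm_of_forall_integral_inner_eq_zero hG
    (Torus.forall_integral_inner_lift_eq_zero hG.continuous horth)) y

/-- The derivative form of `Torus.hasGradientAt_segmentPotential_lift`. [folklore] -/
theorem Torus.hasFDerivAt_segmentPotential_lift (hG : Torus.IsSmooth G)
    (horth : ∀ w : UnitAddTorus d → EuclideanSpace ℝ d, Torus.IsSmooth w → Torus.IsDivFree w →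
      ∫ x, ⟪G x, w x⟫ = 0) (y : EuclideanSpace ℝ d) :
    HasFDerivAt (segmentPotential (Torus.lift G))
      (InnerProductSpace.toDual ℝ (EuclideanSpace ℝ d) (Torus.lift G y)) y :=
  (Torus.hasGradientAt_segmentPotential_lift hG horth y).hasFDerivAt

/-- **The periods of the potential vanish**: for `G` smooth on `T^d` and orthogonal to smooth
divergence-free fields, the segment potential of the lift is `ℤ^d`-periodic. Each period
`Q(y + eⱼ) - Q(y)` is a constant `cⱼ` (zero derivative, `g` being periodic); the periodic function
`θ = Q - ∑ⱼ cⱼ yⱼ` descends to the torus with `∇Θ = G - c`, and testing `G` against the constant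
field `c` gives `|c|² = ∫ ⟪G, c⟫ - ∫ ⟪∇Θ, c⟫ = 0` (integration by parts on the torus,
`Torus.integral_inner_gradient_eq_neg_integral_mul_divergence_holds`). [folklore] -/
theorem Torus.isLatticePeriodic_segmentPotential_lift (hG : Torus.IsSmooth G)
    (horth : ∀ w : UnitAddTorus d → EuclideanSpace ℝ d, Torus.IsSmooth w → Torus.IsDivFree w →
      ∫ x, ⟪G x, w x⟫ = 0) :
    Torus.IsLatticePeriodic (segmentPotential (Torus.lift G)) := by
  set g := Torus.lift G with hg_def
  set Q := segmentPotential g with hQ_def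
  have hgs : ContDiff ℝ ∞ g := hG
  have hQs : ContDiff ℝ ∞ Q := contDiff_segmentPotential hgs
  have hQd : Differentiable ℝ Q := hQs.differentiable (by simp)
  have hDQ : ∀ y, HasFDerivAt Q (InnerProductSpace.toDual ℝ _ (g y)) y :=
    Torus.hasFDerivAt_segmentPotential_lift hG horth
  -- Step 1: each period is a constant
  have hconst : ∀ j : d, ∀ y : EuclideanSpace ℝ d,
      Q (y + EuclideanSpace.single j 1) - Q y = Q (EuclideanSpace.single j 1) - Q 0 := by
    intro j y
    set e : EuclideanSpace ℝ d := EuclideanSpace.single j 1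
    have hdiff : Differentiable ℝ fun y => Q (y + e) - Q y :=
      (hQd.comp (differentiable_id.add (differentiable_const e))).sub hQd
    have hzero : ∀ y, fderiv ℝ (fun y => Q (y + e) - Q y) y = 0 := by
      intro y
      have h1 : HasFDerivAt (fun y => Q (y + e)) (InnerProductSpace.toDual ℝ _ (g (y + e))) y :=
        (hasFDerivAt_comp_add_right e).2 (hDQ (y + e))
      have h2 := h1.sub (hDQ y)
      have hper : g (y + e) = g y := Torus.isLatticePeriodic_lift G j y
      rw [hper, sub_self] at h2
      exact h2.fderiv
    have := is_const_of_fderiv_eq_zero hdiff hzero y 0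
    simpa using this
  -- the constants and the corrected potential
  set c : EuclideanSpace ℝ d := WithLp.toLp 2 fun j => Q (EuclideanSpace.single j 1) - Q 0 with hc
  have hc_apply : ∀ j, c j = Q (EuclideanSpace.single j 1) - Q 0 := fun j => rfl
  set θ : EuclideanSpace ℝ d → ℝ := fun y => Q y - ⟪c, y⟫ with hθ
  -- Step 2: `θ` is periodic
  have hinner_single : ∀ j, ⟪c, EuclideanSpace.single j (1 : ℝ)⟫ = Q (EuclideanSpace.single j 1) - Q 0 := by
    intro j
    rw [EuclideanSpace.inner_single_right]
    simp [hc_apply]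
  have hθper : Torus.IsLatticePeriodic θ := by
    intro j y
    simp only [hθ]
    rw [inner_add_right, hinner_single j]
    linarith [hconst j y]
  -- Step 3: `θ` is smooth with `∇θ = g - c`
  have hlin : ∀ y, HasFDerivAt (fun y : EuclideanSpace ℝ d => ⟪c, y⟫)
      (InnerProductSpace.toDual ℝ (EuclideanSpace ℝ d) c) y := by
    intro y
    have : (fun y : EuclideanSpace ℝ d => ⟪c, y⟫) =
        fun y => InnerProductSpace.toDual ℝ (EuclideanSpace ℝ d) c y := by
      funext y
      rw [InnerProductSpace.toDual_apply_apply]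
    rw [this]
    exact (InnerProductSpace.toDual ℝ (EuclideanSpace ℝ d) c).hasFDerivAt
  have hθs : ContDiff ℝ ∞ θ := hQs.sub (contDiff_const.inner ℝ contDiff_id)
  have hθgrad : ∀ y, HasGradientAt θ (g y - c) y := by
    intro y
    rw [hasGradientAt_iff_hasFDerivAt, map_sub]
    exact (hDQ y).sub (hlin y)
  -- Step 4: descend `θ` to the torus
  set Θ : UnitAddTorus d → ℝ := Torus.descend θ hθper with hΘ
  have hliftΘ : Torus.lift Θ = θ := Torus.lift_descend_holds θ hθper
  have hΘs : Torus.IsSmooth Θ := by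
    show ContDiff ℝ ∞ (Torus.lift Θ)
    rw [hliftΘ]
    exact hθs
  have hgradΘ : ∀ x, Torus.gradient Θ x = G x - c := by
    intro x
    have h1 := Torus.gradient_lift Θ (Torus.repr x)
    rw [Torus.proj_repr] at h1
    rw [← h1, hliftΘ, (hθgrad (Torus.repr x)).gradient, hg_def, Torus.lift_repr]
  -- Step 5: test against the constant field `c`
  have hc0 : c = 0 := by
    have h1 : ∫ x, ⟪G x, c⟫ = 0 := horth (fun _ => c) (Torus.isSmooth_const c) (Torus.isDivFree_const c)
    have hibp : ∫ x, ⟪(fun _ : UnitAddTorus d => c) x, Torus.gradient Θ x⟫ =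
        -∫ x, Θ x * Torus.divergence (fun _ : UnitAddTorus d => c) x :=
      Torus.integral_inner_gradient_eq_neg_integral_mul_divergence_holds (Torus.isSmooth_const c) hΘs
    have hdiv0 : ∀ x, Torus.divergence (fun _ : UnitAddTorus d => c) x = 0 := Torus.isDivFree_const c
    simp only [hdiv0, mul_zero, MeasureTheory.integral_zero, neg_zero] at hibp
    have hsplit : ∀ x, ⟪G x, c⟫ = ⟪c, Torus.gradient Θ x⟫ + ⟪c, c⟫ := by
      intro x
      rw [hgradΘ x, real_inner_comm, inner_sub_right]
      ring
    simp_rw [hsplit] at h1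
    have hint1 : Integrable (fun x => ⟪c, Torus.gradient Θ x⟫) volume :=
      (continuous_const.inner hΘs.gradient.continuous).integrable_unitAddTorus
    rw [integral_add hint1 (integrable_const _), hibp, zero_add, MeasureTheory.integral_const,
      smul_eq_mul, probReal_univ, one_mul] at h1
    exact inner_self_eq_zero.1 h1
  -- conclusion
  intro j y
  have h := hconst j y
  have hcj : Q (EuclideanSpace.single j 1) - Q 0 = 0 := by
    have := hc_apply j
    rw [hc0] at this
    simpa using this.symm
  rw [hcj] at h
  linarith

end Potential

/-! ### The time-dependent reconstruction on `S × T^d` -/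

section SpaceTime

/-- `‖y‖ ≤ card d` on the unit cube: the fundamental domain is bounded. [folklore] -/
theorem Torus.isBounded_unitCube : Bornology.IsBounded (Torus.unitCube d) :=
  (Metric.isBounded_closedBall (x := (0 : EuclideanSpace ℝ d)) (r := Fintype.card d)).subset
    fun _ hy => mem_closedBall_zero_iff.2 (Torus.norm_le_card_of_mem_unitCube hy)

variable {F : Type*} [NormedAddCommGroup F] [NormedSpace ℝ F]

omit [DecidableEq d] in
/-- A smooth function of time is a jointly smooth (space-independent) space–time field. [folklore] -/
theorem Torus.isSmoothSpaceTimeOn_of_contDiffOn {S : Set ℝ} {m : ℝ → F} (hm : ContDiffOn ℝ ∞ m S) :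
    Torus.IsSmoothSpaceTimeOn S (fun t (_ : UnitAddTorus d) => m t) :=
  hm.comp contDiffOn_fst fun _ hp => hp.1

/-- **Smoothness in time of spatial means.** If `q` is jointly smooth on `S × T^d`, `S` open, then
`t ↦ ∫_{T^d} q(t, x) dx` is smooth on `S` (localise in time with a bump supported in `S`, unfold
the torus integral over the unit cube, and differentiate under the integral sign,
`Literature.Analysis.FunctionSpaces.contDiff_parametric_setIntegral`). [folklore] -/
theorem Torus.contDiffOn_integral_of_isSmoothSpaceTimeOn {S : Set ℝ} (hS : IsOpen S)
    {q : ℝ → UnitAddTorus d → F} (hq : Torus.IsSmoothSpaceTimeOn S q) :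
    ContDiffOn ℝ ∞ (fun t => ∫ x, q t x) S := by
  refine hS.contDiffOn_iff.2 fun {t₀} ht₀ => ?_
  obtain ⟨χ, hχ⟩ := exists_contDiffBump_tsupport_subset hS ht₀
  -- the globally smooth localised integrand on `ℝ^d × ℝ`
  have hq' : IsSmoothSpaceTimeOn S (fun t y => q t (Torus.proj y)) := hq
  have hW : ContDiff ℝ ∞ fun z : ℝ × EuclideanSpace ℝ d => (χ : ℝ → ℝ) z.1 • q z.1 (Torus.proj z.2) :=
    hq'.contDiff_smul_of_tsupport_subset hS χ.contDiff hχ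
  set H : EuclideanSpace ℝ d × ℝ → F := fun r => (χ : ℝ → ℝ) r.2 • q r.2 (Torus.proj r.1) with hH
  have hHs : ContDiff ℝ ∞ H := hW.comp (contDiff_snd.prodMk contDiff_fst)
  have hM : ContDiff ℝ ∞ fun t : ℝ => ∫ y in Torus.unitCube d, H (y, t) :=
    FunctionSpaces.contDiff_parametric_setIntegral (μ := volume) Torus.isBounded_unitCube
      Torus.measurableSet_unitCube hHs
  -- near `t₀` the localised integral is the mean
  have heq : (fun t => ∫ x, q t x) =ᶠ[𝓝 t₀] fun t => ∫ y in Torus.unitCube d, H (y, t) := by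
    filter_upwards [χ.eventuallyEq_one] with t ht
    rw [Torus.integral_eq_integral_lift_holds (q t)]
    refine setIntegral_congr_fun Torus.measurableSet_unitCube fun y _ => ?_
    have ht' : (χ : ℝ → ℝ) t = 1 := ht
    simp [hH, ht', Torus.lift_apply]
  exact hM.contDiffAt.congr_of_eventuallyEq heq

omit [Fintype d] [DecidableEq d] in
/-- The torus gradient ignores additive constants (private copy of the identical lemma of
`EulerReynoldsMollification`, not imported here). [folklore] -/
private theorem Torus.gradient_sub_const' [Fintype d] (f : UnitAddTorus d → ℝ) (a : ℝ)
    (x : UnitAddTorus d) : Torus.gradient (fun y => f y - a) x = Torus.gradient f x := by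
  unfold Torus.gradient _root_.gradient
  have : Torus.liftAt (fun y => f y - a) x = fun v => Torus.liftAt f x v - a := rfl
  rw [this, fderiv_sub_const]

/-- **Reconstruction of the pressure on the torus.** Let `S` be an open time set and `G` a
jointly smooth field on `S × T^d` whose slices are `L²`-orthogonal to all smooth divergence-free
fields of `T^d`. Then there is a jointly smooth scalar `q` on `S × T^d` with `∇q(t) = G(t)` and
`∫ q(t) = 0` for every `t ∈ S` (Galdi, Lemma III.1.1; Temam, Ch. I Prop. 1.1 and Rem. 1.6,
periodic case; this is the "mean-free `p_n`" of Buckmaster–Vicol 2019, §2.5). [folklore] -/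
theorem Torus.exists_smooth_pressure_of_forall_integral_inner_eq_zero {S : Set ℝ} (hS : IsOpen S)
    {G : ℝ → UnitAddTorus d → EuclideanSpace ℝ d} (hG : Torus.IsSmoothSpaceTimeOn S G)
    (horth : ∀ t ∈ S, ∀ w : UnitAddTorus d → EuclideanSpace ℝ d, Torus.IsSmooth w →
      Torus.IsDivFree w → ∫ x, ⟪G t x, w x⟫ = 0) :
    ∃ q : ℝ → UnitAddTorus d → ℝ, Torus.IsSmoothSpaceTimeOn S q ∧
      (∀ t ∈ S, ∀ x, Torus.gradient (q t) x = G t x) ∧ (∀ t ∈ S, Torus.HasZeroMean (q t)) := by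
  -- the whole-space potentials and their descent
  set Q : ℝ → EuclideanSpace ℝ d → ℝ := fun t => segmentPotential (Torus.lift (G t)) with hQ
  have hGs : ∀ t ∈ S, Torus.IsSmooth (G t) := fun t ht => hG.isSmooth_slice ht
  have hper : ∀ t ∈ S, Torus.IsLatticePeriodic (Q t) := fun t ht =>
    Torus.isLatticePeriodic_segmentPotential_lift (hGs t ht) (horth t ht)
  have hG' : IsSmoothSpaceTimeOn S (fun t y => G t (Torus.proj y)) := hG
  have hQst : IsSmoothSpaceTimeOn S Q := hG'.segmentIntegral hS
  set q₁ : ℝ → UnitAddTorus d → ℝ := fun t x => Q t (Torus.repr x) with hq₁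
  have hlift : ∀ t ∈ S, Torus.lift (q₁ t) = Q t := by
    intro t ht
    funext y
    obtain ⟨k, hk⟩ := Torus.exists_repr_proj_eq_add_latticeVec_holds y
    have hadd : Q t (y + Torus.latticeVec k) = Q t y :=
      Torus.IsLatticePeriodic.add_latticeVec_holds (hper t ht) y k
    rw [Torus.lift_apply]
    show Q t (Torus.repr (Torus.proj y)) = Q t y
    rw [hk, hadd]
  have hq₁s : Torus.IsSmoothSpaceTimeOn S q₁ := by
    refine (hQst : ContDiffOn ℝ ∞ (uncurry Q) (S ×ˢ univ)).congr fun p hp => ?_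
    obtain ⟨t, y⟩ := p
    have ht : t ∈ S := hp.1
    show q₁ t (Torus.proj y) = Q t y
    rw [← hlift t ht, Torus.lift_apply]
  have hgrad₁ : ∀ t ∈ S, ∀ x, Torus.gradient (q₁ t) x = G t x := by
    intro t ht x
    have h1 := Torus.gradient_lift (q₁ t) (Torus.repr x)
    rw [Torus.proj_repr] at h1
    rw [← h1, hlift t ht,
      (Torus.hasGradientAt_segmentPotential_lift (hGs t ht) (horth t ht) (Torus.repr x)).gradient,
      Torus.lift_repr]
  -- the mean and the mean-free pressure
  set m : ℝ → ℝ := fun t => ∫ x, q₁ t x with hm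
  have hms : ContDiffOn ℝ ∞ m S := Torus.contDiffOn_integral_of_isSmoothSpaceTimeOn hS hq₁s
  refine ⟨fun t x => q₁ t x - m t, hq₁s.sub (Torus.isSmoothSpaceTimeOn_of_contDiffOn hms),
    fun t ht x => ?_, fun t ht => ?_⟩
  · rw [Torus.gradient_sub_const', hgrad₁ t ht x]
  · have hint : Integrable (q₁ t) volume :=
      (hq₁s.isSmooth_slice ht).continuous.integrable_unitAddTorus
    show ∫ x, (q₁ t x - m t) = 0
    rw [integral_sub hint (integrable_const _), MeasureTheory.integral_const, smul_eq_mul,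
      probReal_univ, one_mul, hm]
    exact sub_self _

end SpaceTime


end Literature.Analysis.FluidPDE

end
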